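import Summits.BirchSwinnertonDyer.BirchSwinnertonDyer.Theorems.ByReductionTypeAtTwoOrdKatoHalfAtTwoIsoKolyvaginRankOneTwo
import Summits.BirchSwinnertonDyer.BirchSwinnertonDyer.Theorems.ByReductionTypeAtTwoOrdKatoHalfAtTwoIsoSelmerSideTwo
import Summits.BirchSwinnertonDyer.BirchSwinnertonDyer.Theorems.ByReductionTypeAtTwoOrdKatoHalfAtTwoIsoChebotarevTranspositionTwo
import HarnessLib

/-!
# stub-ideation `sidea-stub_port-2` GEN 2 — BY-NAME CLOSURE PROBE of `stub_port` (socket 1 of line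
# `steinberg-fibre-at-two`, crux stmt-BirchSwinnertonDyer-19573) from TREE THEOREMS ONLY.

HONEST FRAMING (cell bsd-2adic): BSD is not proved by any of this; the crux `OrdKatoHalfAtTwoIso` is NOT proved
(skeleton v7 still has four memo/cite stubs `stub_F1_two`, `stub_AU`, `stub_B7B8_katoOffResidue_memo`, `stub_pub`).
What this file certifies: the research constant `CoreTheoremATwoResidue` (the statement of the stub `stub_port` this
ideation seat was minted for) is now a theorem of the TREE, by the rank-one Ω-road of `STUB-IDEAS-stub_port-2.md` (gen 0):
`stub_port_of_rankOne` (p658966) applied to `stub_T1_selmerSideTwo` (p663770), `stub_HC_chebotarevTranspositionTwo`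
(p662346) and `stub_HK_kolyvaginRankOneTwo` (p668150, landed 2026-08-28T21:07:10Z). No skeleton file is imported; no `sorry`.
(Card #9's displayed statement `SignBlindKolyvaginPrimes.RankOneOmegaPortAtTwo` is the same Prop by `Iff.rfl` — gen-0 sketch
`Lines/sign_blind_kolyvagin_primes_sketch.lean` l.142, rc 0 — hence a theorem too; not re-imported here.)
-/

namespace Summit.BirchSwinnertonDyer.BirchSwinnertonDyer.Cruxes.OrdKatoHalfAtTwoIso.SideaStubPortTwoGen2

open Summit.BirchSwinnertonDyer.BirchSwinnertonDyer.Theorems.SteinbergFibreAtTwo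

/-- `stub_port`'s statement, by name, from tree theorems only. -/
theorem socket1_port_by_name : CoreTheoremATwoResidue :=
  stub_port_of_rankOne stub_T1_selmerSideTwo stub_HC_chebotarevTranspositionTwo stub_HK_kolyvaginRankOneTwo

#print axioms socket1_port_by_name

end Summit.BirchSwinnertonDyer.BirchSwinnertonDyer.Cruxes.OrdKatoHalfAtTwoIso.SideaStubPortTwoGen2
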